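import Summits.BirchSwinnertonDyer.BirchSwinnertonDyer.Theorems.KatoDescentPotSupersingularIntegralH1RankZero

set_option linter.dupNamespace false
set_option autoImplicit false

/-! # Crux M `ReducibleKatoMember` (stmt-BirchSwinnertonDyer-19196): on the package `Kato2004.MemberHullInputs`
the clause `index_ne_zero` (Kato Thm. 14.5 (2)) is EQUIVALENT to «the bottom class `proj₀ 𝐲` is not torsion» —
a statement about PINNED objects only (part 4, addendum to parts 1–3 `…IntegralH1RankZero{Levelwise,Dichotomy,}.lean`)

Cell `bsd-potss`, prover seat `bsd-potss-rkm` g9.  Supports, does not close, stmt-BirchSwinnertonDyer-19196.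
Theorems only (no definition, no named fact, no `sorry`); route-free.

With (R0) (`rank_integralH1_layerZero_le_one`, part 3) the module `A = H¹(ℤ[1/p], T_pW)` of a package has
`ℤ_p`-rank `≤ 1`, and it contains a class of infinite order as soon as `𝐇¹_Γ ≠ 0` (cn100's
`IwasawaH1Data.exists_proj_zero_not_isOfFinAddOrder` with (α), (12.2.1), torsion-freeness — all theorems); the span
`Λ · ι(𝐲̄)` is `ℤ_p · proj₀ 𝐲` under the pin (`Λ` acts on `A` through `g ↦ g(0)`).  Hence, for `W(ℚ)` and `Ш(W)[p^∞]`
finite (`κ` cyclotomic, `γ` a topological generator):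

* **`MemberHullInputs.natCard_quotient_span_ne_zero_of_not_isOfFinAddOrder`**: `proj₀ 𝐲` of infinite order ⟹
  `#(A / Λ·ι(𝐲̄)) ≠ 0` (the quotient of a rank-`≤ 1` finitely generated `ℤ_p`-module by a submodule with a
  non-torsion element is finite) — the clause `index_ne_zero`, from the pinned statement;
* **`MemberHullInputs.not_isOfFinAddOrder_of_natCard_quotient_span_ne_zero`**: conversely `index_ne_zero` ⟹ `proj₀ 𝐲`
  has infinite order (else `Λ·ι(𝐲̄)` is finite inside the infinite `A`);
* **`MemberHullInputs.index_ne_zero_iff_not_isOfFinAddOrder_proj_zero`**: the equivalence.  Neither direction uses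
  the fields `index_ne_zero`, `count`, `finite_coinvariants_H2` of the package.

So on the roads of crux M the transcription clause `index_ne_zero` of the held input
`Kato2004.exists_memberHullInputs` (item 19659) may be replaced by the PINNED clause «`I.proj 0 𝐲` is not of finite
order» — whose printed content is the non-vanishing of the bottom dual-exponential value
`exp*(z_{0,∅}) = κ · L_{(pA)}(E,1)/Ω⁺ · R⁻(c,d,a,A)` (Thm. 12.5 (1) with `L(E,1) ≠ 0`; tree
`GaloisImage.KatoValue.zetaBody_value_level_one`).  HONEST FRAMING: bookkeeping over tree theorems; no named fact;
nothing about the zeta side, the leaf or BSD is proved.  PARTITION (D-0054): types-the-object-of the clause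
`index_ne_zero` of held input 19659 of crux M (B5 O6 wild 3 × X3 reducible rows + B4 (t′) X3 rows); closes NONE.

References: [Kato2004Asterisque] Thm. 14.5 (1)(2) (p. 236), Thm. 12.5 (1) (p. 221), §14.14 (14.14.1) (p. 243). -/

noncomputable section

open scoped Classical

namespace Summit.BirchSwinnertonDyer.BirchSwinnertonDyer.Theorems.IntegralH1RankZero

open Function Field
open Literature.NumberTheory.GaloisRepresentations
open Literature.NumberTheory.EllipticCurves Literature.NumberTheory.EllipticCurves.Kato2004
open Literature.NumberTheory.EllipticCurves.Kato2004.EulerSystemValues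
open Literature.NumberTheory.EllipticCurves.IwasawaAlgebra

/-! ## Two `ℤ_p`-module lemmas (the private §1 of cn100's `DescentCokernelFiniteOfRankLeOneProofs`, re-proved) -/

section ZpModule

variable (p : ℕ) [Fact p.Prime]

/-- In a `ℤ_p`-module, an element killed by a non-zero `p`-adic integer has finite additive order
(`a = u·p^v` with `u` a unit). [folklore] -/
theorem isOfFinAddOrder_of_smul_eq_zero {N : Type*} [AddCommGroup N] [Module ℤ_[p] N] {a : ℤ_[p]}
    (ha : a ≠ 0) {x : N} (hx : a • x = 0) : IsOfFinAddOrder x := by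
  have hp : p.Prime := Fact.out
  set u := PadicInt.unitCoeff ha
  have h1 : ((p : ℤ_[p]) ^ a.valuation) • x = 0 := by
    have e : (p : ℤ_[p]) ^ a.valuation = ((u⁻¹ : ℤ_[p]ˣ) : ℤ_[p]) * a := by
      conv_rhs => rw [PadicInt.unitCoeff_spec ha]
      rw [← mul_assoc, Units.inv_mul, one_mul]
    rw [e, mul_smul, hx, smul_zero]
  refine isOfFinAddOrder_iff_nsmul_eq_zero.mpr ⟨p ^ a.valuation, pow_pos hp.pos _, ?_⟩
  rw [← Nat.cast_smul_eq_nsmul ℤ_[p], Nat.cast_pow]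
  exact h1

/-- **Rank bookkeeping over `ℤ_p`.**  For a finitely generated `ℤ_p`-module `A` of rank `≤ 1` and a submodule `B`
containing an element of infinite order, `A/B` is finite (rank–nullity: `A/B` is finitely generated torsion,
and the torsion of a finitely generated `ℤ_p`-module is finite, `ZpCorank.finite_torsion`). [folklore] -/
theorem finite_quotient_of_rank_le_one {A : Type*} [AddCommGroup A] [Module ℤ_[p] A]
    [Module.Finite ℤ_[p] A] (hA : Module.rank ℤ_[p] A ≤ 1) (B : Submodule ℤ_[p] A) {b : A}
    (hbB : b ∈ B) (hb : ¬ IsOfFinAddOrder b) : Finite (A ⧸ B) := by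
  haveI : IsNoetherian ℤ_[p] A := isNoetherian_of_isNoetherianRing_of_finite ℤ_[p] A
  haveI : Module.Finite ℤ_[p] B := Module.IsNoetherian.finite ℤ_[p] B
  have hBtors : ¬ Module.IsTorsion ℤ_[p] B := by
    intro htors
    obtain ⟨⟨a, ha⟩, hab⟩ := @htors ⟨b, hbB⟩
    have ha0 : (a : ℤ_[p]) ≠ 0 := nonZeroDivisors.ne_zero ha
    have hab' : a • b = 0 := by
      have := congrArg Subtype.val hab
      simpa using this
    exact hb (isOfFinAddOrder_of_smul_eq_zero p ha0 hab')
  have hB : Module.finrank ℤ_[p] B ≠ 0 := by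
    rwa [Ne, Module.finrank_eq_zero_iff_isTorsion]
  have hAfin : Module.finrank ℤ_[p] A ≤ 1 := Module.finrank_le_of_rank_le (by exact_mod_cast hA)
  have hsum := Submodule.finrank_quotient_add_finrank B
  have hQ : Module.finrank ℤ_[p] (A ⧸ B) = 0 := by omega
  rw [Module.finrank_eq_zero_iff_isTorsion] at hQ
  have htop : Submodule.torsion ℤ_[p] (A ⧸ B) = ⊤ := by
    rw [eq_top_iff]
    intro x _
    exact hQ (x := x)
  haveI := ZpCorank.finite_torsion p (A ⧸ B)
  exact Finite.of_equiv _ (LinearEquiv.ofTop _ htop).toEquiv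

end ZpModule

/-! ## The clause `index_ne_zero` versus the order of `proj₀ 𝐲` -/

section Member

variable {W : WeierstrassCurve ℚ} [W.IsElliptic] {p : ℕ} [Fact p.Prime]
  [ContinuousSMul ℤ_[p] (W.tateModule p)] {κ : ZpExtension ℚ p} {γ : absoluteGaloisGroup ℚ}
  {I : IwasawaH1Data W p κ γ} {y : I.H}

/-- The pin of `A` as an additive isomorphism `A ≃+ H¹(ℤ[1/p], T_pW)` (`toH1` corestricted; the `IwasawaH2Data`
plumbing `integralH1Equiv` read on the `(A, toH1)`-fields of a `MemberHullInputs`).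
[cite: Kato2004Asterisque, §8.2 and Lemma 8.5 (pp. 180–184)] -/
theorem MemberHullInputs.exists_addEquiv_integralH1 (D : MemberHullInputs W p κ γ I y) :
    ∃ e : D.A ≃+ integralH1 (tateRep W p) p (κ.layerSubgroup 0),
      ∀ a : D.A, (e a : H1 (tateRep W p) (κ.layerSubgroup 0)) = D.toH1 a := by
  have hmem : ∀ a : D.A, D.toH1 a ∈ integralH1 (tateRep W p) p (κ.layerSubgroup 0) := fun a =>
    (D.mem_range_toH1_iff _).mp ⟨a, rfl⟩
  let f : D.A →+ integralH1 (tateRep W p) p (κ.layerSubgroup 0) :=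
    D.toH1.codRestrict (integralH1 (tateRep W p) p (κ.layerSubgroup 0)).toAddSubgroup hmem
  have hf : Bijective f := by
    refine ⟨fun a b h => D.toH1_injective (by simpa [f] using congrArg Subtype.val h), fun x => ?_⟩
    obtain ⟨a, ha⟩ := (D.mem_range_toH1_iff (x : H1 (tateRep W p) (κ.layerSubgroup 0))).mpr x.2
    exact ⟨a, Subtype.ext ha⟩
  exact ⟨AddEquiv.ofBijective f hf, fun _ => rfl⟩

/-- **Under the pin, `Λ · ι(𝐲̄) ⊆ A` is `ℤ_p · proj₀ 𝐲 ⊆ H¹(ℤ[1/p], T_pW)`** (`Λ` acts on `A` through the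
augmentation, `toH1_smul`, and `toH1 (ι 𝐲̄) = proj₀ 𝐲`, `toH1_ι`). [cite: Kato2004Asterisque, §14.14 (14.14.1) (p. 243)] -/
theorem MemberHullInputs.map_span_eq_span_projZero (D : MemberHullInputs W p κ γ I y)
    (e : D.A ≃+ integralH1 (tateRep W p) p (κ.layerSubgroup 0))
    (he : ∀ a : D.A, (e a : H1 (tateRep W p) (κ.layerSubgroup 0)) = D.toH1 a) :
    ((IwasawaAlgebra p) ∙ D.ι (Submodule.Quotient.mk y)).toAddSubgroup.map (e : D.A →+ _) =
      ((ℤ_[p]) ∙ (⟨I.proj 0 y, I.proj_mem 0 y⟩ : integralH1 (tateRep W p) p (κ.layerSubgroup 0))).toAddSubgroup := by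
  ext x
  simp only [AddSubgroup.mem_map, Submodule.mem_toAddSubgroup, Submodule.mem_span_singleton, AddMonoidHom.coe_coe]
  constructor
  · rintro ⟨a, ⟨g, rfl⟩, rfl⟩
    refine ⟨PowerSeries.constantCoeff g, Subtype.ext ?_⟩
    rw [Submodule.coe_smul, he, D.toH1_smul, D.toH1_ι]
  · rintro ⟨c, rfl⟩
    refine ⟨(PowerSeries.C c : IwasawaAlgebra p) • D.ι (Submodule.Quotient.mk y), ⟨PowerSeries.C c, rfl⟩,
      Subtype.ext ?_⟩
    rw [he, D.toH1_smul, D.toH1_ι, PowerSeries.constantCoeff_C, Submodule.coe_smul]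

/-- **`proj₀ 𝐲` of infinite order ⟹ `index_ne_zero`.**  On a package `D : MemberHullInputs W p κ γ I y` with `W(ℚ)`
and `Ш(W)[p^∞]` finite: if the bottom class `I.proj 0 y ∈ H¹(ℚ, T_pW)` is not of finite order, then
`#(A / Λ·ι(𝐲̄)) ≠ 0`, i.e. the index `[A : Λ·ι(𝐲̄)]` is finite — by (R0) (`rank_integralH1_layerZero_le_one`) and
rank bookkeeping over `ℤ_p`, transported along the pin.  Uses no field of `D` beyond the `(A, toH1, ι)`-pin.
[cite: Kato2004Asterisque, Thm. 14.5 (1)(2) (p. 236)] -/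
theorem MemberHullInputs.natCard_quotient_span_ne_zero_of_not_isOfFinAddOrder (D : MemberHullInputs W p κ γ I y)
    [Finite W.toAffine.Point] [Finite (AddCommGroup.primaryComponent W.sha p)]
    (hy : ¬ IsOfFinAddOrder (I.proj 0 y)) :
    Nat.card (D.A ⧸ (IwasawaAlgebra p) ∙ D.ι (Submodule.Quotient.mk y)) ≠ 0 := by
  obtain ⟨e, he⟩ := MemberHullInputs.exists_addEquiv_integralH1 D
  haveI := module_finite_integralH1_layerZero W p κ
  set y₀ : integralH1 (tateRep W p) p (κ.layerSubgroup 0) := ⟨I.proj 0 y, I.proj_mem 0 y⟩ with hy₀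
  have hy₀' : ¬ IsOfFinAddOrder y₀ := by
    intro hfin
    apply hy
    obtain ⟨n, hn, hny⟩ := hfin.exists_nsmul_eq_zero
    exact isOfFinAddOrder_iff_nsmul_eq_zero.mpr ⟨n, hn, by simpa [hy₀] using congrArg Subtype.val hny⟩
  have hfin : Finite (integralH1 (tateRep W p) p (κ.layerSubgroup 0) ⧸ (ℤ_[p]) ∙ y₀) :=
    finite_quotient_of_rank_le_one p (rank_integralH1_layerZero_le_one W p κ) _
      (Submodule.mem_span_singleton_self y₀) hy₀'
  have eq : (D.A ⧸ (IwasawaAlgebra p) ∙ D.ι (Submodule.Quotient.mk y)) ≃+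
      (integralH1 (tateRep W p) p (κ.layerSubgroup 0) ⧸ (ℤ_[p]) ∙ y₀) :=
    QuotientAddGroup.congr ((IwasawaAlgebra p) ∙ D.ι (Submodule.Quotient.mk y)).toAddSubgroup
      ((ℤ_[p]) ∙ y₀).toAddSubgroup e (MemberHullInputs.map_span_eq_span_projZero D e he)
  haveI : Finite (D.A ⧸ (IwasawaAlgebra p) ∙ D.ι (Submodule.Quotient.mk y)) := Finite.of_equiv _ eq.symm.toEquiv
  exact Nat.card_pos.ne'

/-- **`index_ne_zero` ⟹ `proj₀ 𝐲` of infinite order** (`κ` cyclotomic, `γ` a topological generator).  If `proj₀ 𝐲`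
had finite order, `Λ·ι(𝐲̄) ≅ ℤ_p · proj₀ 𝐲` would be finite, while `A ≅ H¹(ℤ[1/p], T_pW)` is infinite: it contains
`proj₀ h` of infinite order for some `h ∈ 𝐇¹_Γ` (cn100's `IwasawaH1Data.exists_proj_zero_not_isOfFinAddOrder`, with
(α) `TwistTate.mem_TSubmodule_of_proj_zero_eq_zero`, (12.2.1), torsion-freeness, and `𝐇¹_Γ ≠ 0` from the zeta
fields, `MemberHullInputs.nontrivial_H`); so `A / Λ·ι(𝐲̄)` is infinite and its `Nat.card` is `0`.
[cite: Kato2004Asterisque, Thm. 14.5 (2) (p. 236) and §14.14 (14.14.1) (p. 243)] -/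
theorem MemberHullInputs.not_isOfFinAddOrder_of_natCard_quotient_span_ne_zero (hκ : κ.IsCyclotomic)
    (hγ : κ.IsTopGenerator γ) (D : MemberHullInputs W p κ γ I y)
    (h : Nat.card (D.A ⧸ (IwasawaAlgebra p) ∙ D.ι (Submodule.Quotient.mk y)) ≠ 0) :
    ¬ IsOfFinAddOrder (I.proj 0 y) := by
  intro hy
  obtain ⟨e, he⟩ := MemberHullInputs.exists_addEquiv_integralH1 D
  haveI : Module.Finite (IwasawaAlgebra p) I.H := IwasawaH1Data.module_finite_of_isCyclotomic hκ hγ I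
  haveI : Module.IsTorsionFree (IwasawaAlgebra p) I.H := IwasawaH1Data.isTorsionFree hγ I
  haveI := MemberHullInputs.nontrivial_H D
  haveI := module_finite_integralH1_layerZero W p κ
  -- `A` is infinite: it contains a class of infinite order
  obtain ⟨h₁, hh₁⟩ := I.exists_proj_zero_not_isOfFinAddOrder
    (fun x hx => TwistTate.mem_TSubmodule_of_proj_zero_eq_zero W p κ hκ hγ I x hx)
  have hAinf : Infinite D.A := by
    obtain ⟨a, ha⟩ := (D.mem_range_toH1_iff (I.proj 0 h₁)).mpr (I.proj_mem 0 h₁)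
    have ha' : ¬ IsOfFinAddOrder a := fun hfin => hh₁ (ha ▸ D.toH1.isOfFinAddOrder hfin)
    exact Infinite.of_injective _ (injective_zsmul_iff_not_isOfFinAddOrder.mpr ha')
  -- `ℤ_p · proj₀ 𝐲` is finite (finitely generated torsion over `ℤ_p`)
  let y₀ : integralH1 (tateRep W p) p (κ.layerSubgroup 0) := ⟨I.proj 0 y, I.proj_mem 0 y⟩
  have hy₀fin : IsOfFinAddOrder y₀ := by
    obtain ⟨n, hn, hny⟩ := hy.exists_nsmul_eq_zero
    exact isOfFinAddOrder_iff_nsmul_eq_zero.mpr ⟨n, hn, Subtype.ext (by simpa [y₀] using hny)⟩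
  obtain ⟨n, hn, hny₀⟩ := hy₀fin.exists_nsmul_eq_zero
  haveI : IsNoetherian ℤ_[p] (integralH1 (tateRep W p) p (κ.layerSubgroup 0)) :=
    isNoetherian_of_isNoetherianRing_of_finite ℤ_[p] _
  haveI : Module.Finite ℤ_[p] ((ℤ_[p]) ∙ y₀) := Module.IsNoetherian.finite ℤ_[p] _
  have htors : Submodule.torsion ℤ_[p] ((ℤ_[p]) ∙ y₀) = ⊤ := by
    rw [eq_top_iff]
    rintro ⟨x, hx⟩ -
    obtain ⟨c, rfl⟩ := Submodule.mem_span_singleton.mp hx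
    rw [Submodule.mem_torsion_iff]
    refine ⟨⟨(n : ℤ_[p]), mem_nonZeroDivisors_of_ne_zero (Nat.cast_ne_zero.mpr hn.ne')⟩, Subtype.ext ?_⟩
    change (n : ℤ_[p]) • c • y₀ = 0
    rw [smul_comm, Nat.cast_smul_eq_nsmul, hny₀, smul_zero]
  have hfin₀ : Finite ((ℤ_[p]) ∙ y₀) := by
    haveI := ZpCorank.finite_torsion p ((ℤ_[p]) ∙ y₀)
    exact Finite.of_equiv _ (LinearEquiv.ofTop _ htors).toEquiv
  -- hence `Λ · ι(𝐲̄)` is finite (it maps onto `ℤ_p · proj₀ 𝐲` under the pin)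
  have hfinS : Finite ((IwasawaAlgebra p) ∙ D.ι (Submodule.Quotient.mk y)).toAddSubgroup := by
    have hmap := MemberHullInputs.map_span_eq_span_projZero D e he
    have hfin' : Finite (((IwasawaAlgebra p) ∙ D.ι (Submodule.Quotient.mk y)).toAddSubgroup.map
        (e : D.A →+ integralH1 (tateRep W p) p (κ.layerSubgroup 0))) := by
      rw [hmap]
      exact hfin₀
    exact Finite.of_equiv _ (AddSubgroup.equivMapOfInjective
      ((IwasawaAlgebra p) ∙ D.ι (Submodule.Quotient.mk y)).toAddSubgroup
      (e : D.A →+ integralH1 (tateRep W p) p (κ.layerSubgroup 0)) e.injective).symm.toEquiv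
  -- an infinite group modulo a finite subgroup is infinite
  haveI := hfinS
  have hcard := AddSubgroup.card_eq_card_quotient_mul_card_addSubgroup
    ((IwasawaAlgebra p) ∙ D.ι (Submodule.Quotient.mk y)).toAddSubgroup
  rw [Nat.card_eq_zero_of_infinite] at hcard
  rcases zero_eq_mul.mp hcard with h0 | h0
  · exact h h0
  · exact (Nat.card_pos (α := ((IwasawaAlgebra p) ∙ D.ι (Submodule.Quotient.mk y)).toAddSubgroup)).ne' h0

/-- **`index_ne_zero` ⟺ «`proj₀ 𝐲` is not torsion»** on a package of crux M with `W(ℚ)` and `Ш(W)[p^∞]` finite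
(`κ` cyclotomic, `γ` a topological generator): the clause of Kato Thm. 14.5 (2) in `Kato2004.MemberHullInputs` is
equivalent to a statement about the PINNED bottom class `I.proj 0 𝐲 ∈ H¹(ℚ, T_pW)` — its printed content being
`exp*(proj₀ 𝐲) = λ(0) · exp*(z_γ) ≠ 0` (Thm. 12.5 (1), `L(E,1) ≠ 0`).  Neither direction uses the fields
`index_ne_zero`, `count`, `finite_coinvariants_H2`. [cite: Kato2004Asterisque, Thm. 14.5 (2) (p. 236), Thm. 12.5 (1) (p. 221)] -/
theorem MemberHullInputs.index_ne_zero_iff_not_isOfFinAddOrder_proj_zero (hκ : κ.IsCyclotomic)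
    (hγ : κ.IsTopGenerator γ) (D : MemberHullInputs W p κ γ I y) [Finite W.toAffine.Point]
    [Finite (AddCommGroup.primaryComponent W.sha p)] :
    Nat.card (D.A ⧸ (IwasawaAlgebra p) ∙ D.ι (Submodule.Quotient.mk y)) ≠ 0 ↔ ¬ IsOfFinAddOrder (I.proj 0 y) :=
  ⟨MemberHullInputs.not_isOfFinAddOrder_of_natCard_quotient_span_ne_zero hκ hγ D,
    MemberHullInputs.natCard_quotient_span_ne_zero_of_not_isOfFinAddOrder D⟩

end Member

end Summit.BirchSwinnertonDyer.BirchSwinnertonDyer.Theorems.IntegralH1RankZero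

end
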